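import Summits.CriticalPhenomena.PercolationContinuityZ3.Theorems.PercNearOneGluingNoHeavyLowerTailTformPairExchange
import HarnessLib

/-!
# `NoHeavyLowerTail` (stmt-CriticalPhenomena-4575) — GLUE-ADM for a glued PAIR splits exactly into an `x`-free part
# (COND-CIL: the attached-champion inequality under avoidance conditioning) and a `c`-free part (RED0)

Support file (prover `prim-hp-5`, hull-port cell, T-form calculus, gen 6; `--supports stmt-CriticalPhenomena-4575`).
No definitions, no named facts, no sorries.  `μ = prodBernoulli w`, relays `A`, level `j`, `N_v = |{a ∈ A : v ↔ a}|`,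
`N_B = |{a ∈ A : y ↔ a ∨ z ↔ a}|` for the pair `B = {y, z}`; events `L_v = {N_v ≤ j}`, `A_v = {1 ≤ N_v}` (attached),
`V_v = {j < N_v}` (heavy), `M_v = A_v ∖ V_v` (attached-light), `Z_v = A_vᶜ` (unattached), `x ~ B = {x ↔ y} ∪ {x ↔ z}`.

GLUE-ADM (hypothesis `hGlue` of `Theorems.noHeavyLowerTail_of_gluedWitness₂`, to which the crux is reduced) asks, for a relay
`x` that is a T-witness of `y` and of `z`, for every relay `c`:
    `μ(x ≁ B, M_B) + μ(Z_B, L_c) ≤ μ(x ≁ B, L_x)`.                                                        (GLUE_c)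
The seat memo (run/shared/lean/prim/prim-hp-5/OBSERVER-SET.md §11) records the exact identity
    `GLUE_c-margin = [θ_a(y) − Φ(x)] + [μ(Z_y ∩ F_c(z)) − μ(Z_y ∩ L_a)] + [PFT(y) − μ(x ≁ B, M_y, V_B)]`   (every `a`),
`F_c(z) = M_z ∪ (Z_z ∩ L_c)`, `PFT(y) = μ(x↔z, y↮z, V_y, L_x) − μ(x↔z, y↮z, M_y, V_z)`, and hence the reduction proved here:

* `gluedPair_of_priorityWitness` — **(GLUE_c) follows from one inequality**, the T-witness inequality (off `{x ~ B}`) for the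
  PRIORITY observer `y ▹ z` (read `y` if attached, else `z`, else fall back to `c`):
  `μ(x ≁ B, M_y) + μ(x ↮ z, Z_y, M_z) + μ(Z_y, Z_z, L_c) ≤ μ(x ≁ B, L_x)` (pointwise inclusion; census 0 violations for both orders).
* `gluedPair_of_condCIL_red0` — **(GLUE_c) follows from**
  (COND-CIL at `c`, witnessed by `a`)  `μ(Z_y ∩ M_z) + μ(Z_y ∩ Z_z ∩ L_c) ≤ μ(Z_y ∩ L_a)`  — the attached-champion inequality for
  the observer `z` under the measure `μ(· ∩ {y ↮ A})`, an `x`-FREE statement — and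
  (RED0 at `a`)  `μ(M_y) + μ(Z_y ∩ L_a) + μ(x↔z, y↮z, V_y, L_x) ≤ μ(L_x) + μ(x↔z, y↮z, M_y, V_z)`  — the T-witness inequality
  for `(y, x)` at `a` with the two T-form events restricted off `{x ↔ z}`, a `c`-FREE statement.
  Only `x ∈ A` is used; the proof is finite additivity plus four event identities (`{x↔y} ∩ M_y = {x↔y} ∩ L_x`,
  `{x↔z} ∩ L_xᶜ = {x↔z} ∩ V_z`, `{x↔z} ∩ Z_y ∩ M_z = {x↔z} ∩ Z_y ∩ L_x`, `Z_B = Z_y ∩ Z_z`) and the inclusion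
  `{x ≁ B} ∩ M_B ⊆ ({x ≁ B} ∩ M_y) ∪ (Z_y ∩ M_z ∩ {x ↮ z})` (whose slack is exactly the bonus `μ(x ≁ B, M_y, V_B)`).

Census (seat, exact, n ≤ 7 + SA climbs): both hypotheses hold with 0 violations for at least one ordering of the pair whenever `x`
is a T-witness of both members (RED0 can fail for the member `x` is less attached to; COND-CIL never failed); so this file is
the |B| = 2 case of GLUE-ADM reduced to two cleaner conjectures.  The T-part `heavy_pairExchange`/`gluingGain_le` is already a
theorem (file `…TformPairExchange`).
-/

noncomputable section

namespace Summit.CriticalPhenomena.PercolationContinuityZ3.Theorems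

open MeasureTheory Set Literature.Probability.LatticeModels Literature.Probability.Percolation
open scoped Classical BigOperators

variable {V : Type*} [Fintype V]

omit [Fintype V] in
/-- **GLUE-ADM for a pair from a PRIORITY WITNESS.**  For `x ∈ A`, vertices `y, z, c`, level `j`, `B = {y, z}`:
if `x` is a T-witness (off `{x ~ B}`) for the PRIORITY observer `y ▹ z` — the observer that reads `y`'s cluster when `y` is
attached, else `z`'s cluster, else falls back to `c` —
`μ(x ≁ B, M_y) + μ(x ↮ z, Z_y, M_z) + μ(Z_y, Z_z, L_c) ≤ μ(x ≁ B, L_x)`,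
then `x` is a T-witness for the glued pair at `c`: `μ(x ≁ B, 1 ≤ N_B ≤ j) + μ(N_B = 0, N_c ≤ j) ≤ μ(x ≁ B, N_x ≤ j)`.
(Pointwise: `{x ≁ B} ∩ {1 ≤ N_B ≤ j} ⊆ ({x ≁ B} ∩ M_y) ∪ (Z_y ∩ M_z ∩ {x ↮ z})` and `{N_B = 0} = Z_y ∩ Z_z`; the slack is
`μ(x ≁ B, M_y, N_B > j)`.)  Seat census: 0 violations for BOTH orders whenever `x` is a T-witness of `y` and of `z`
(memo OBSERVER-SET.md §12). [cite: KozmaNitzan2024, §3.2 (pp. 12–14)] -/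
theorem gluedPair_of_priorityWitness (w : Sym2 V → unitInterval) (A : Finset V) (x y z c : V) (j : ℕ)
    (hPW : (prodBernoulli w).real
            ((openConn x y ∪ openConn x z)ᶜ ∩
              {ω : BondConfig V | 1 ≤ (A.filter fun b => ω ∈ openConn y b).card ∧
                (A.filter fun b => ω ∈ openConn y b).card ≤ j}) +
          (prodBernoulli w).real
            ({ω : BondConfig V | ¬ 1 ≤ (A.filter fun b => ω ∈ openConn y b).card} ∩
              {ω | 1 ≤ (A.filter fun b => ω ∈ openConn z b).card ∧ (A.filter fun b => ω ∈ openConn z b).card ≤ j} ∩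
              (openConn x z)ᶜ) +
          (prodBernoulli w).real
            ({ω : BondConfig V | ¬ 1 ≤ (A.filter fun b => ω ∈ openConn y b).card} ∩
              {ω | ¬ 1 ≤ (A.filter fun b => ω ∈ openConn z b).card} ∩
              {ω | (A.filter fun b => ω ∈ openConn c b).card ≤ j}) ≤
        (prodBernoulli w).real
            ((openConn x y ∪ openConn x z)ᶜ ∩ {ω : BondConfig V | (A.filter fun b => ω ∈ openConn x b).card ≤ j})) :
    (prodBernoulli w).real
        ((openConn x y ∪ openConn x z)ᶜ ∩
          {ω : BondConfig V | 1 ≤ (A.filter fun b => ω ∈ openConn y b ∨ ω ∈ openConn z b).card ∧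
            (A.filter fun b => ω ∈ openConn y b ∨ ω ∈ openConn z b).card ≤ j}) +
      (prodBernoulli w).real
        ({ω : BondConfig V | ¬ 1 ≤ (A.filter fun b => ω ∈ openConn y b ∨ ω ∈ openConn z b).card} ∩
          {ω | (A.filter fun b => ω ∈ openConn c b).card ≤ j}) ≤
    (prodBernoulli w).real
        ((openConn x y ∪ openConn x z)ᶜ ∩ {ω : BondConfig V | (A.filter fun b => ω ∈ openConn x b).card ≤ j}) := by
  classical
  set μ := prodBernoulli w
  set XY : Set (BondConfig V) := openConn x y
  set XZ : Set (BondConfig V) := openConn x z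
  set Lc : Set (BondConfig V) := {ω : BondConfig V | (A.filter fun b => ω ∈ openConn c b).card ≤ j}
  set My : Set (BondConfig V) :=
    {ω : BondConfig V | 1 ≤ (A.filter fun b => ω ∈ openConn y b).card ∧ (A.filter fun b => ω ∈ openConn y b).card ≤ j}
  set Mz : Set (BondConfig V) :=
    {ω : BondConfig V | 1 ≤ (A.filter fun b => ω ∈ openConn z b).card ∧ (A.filter fun b => ω ∈ openConn z b).card ≤ j}
  set MB : Set (BondConfig V) :=
    {ω : BondConfig V | 1 ≤ (A.filter fun b => ω ∈ openConn y b ∨ ω ∈ openConn z b).card ∧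
      (A.filter fun b => ω ∈ openConn y b ∨ ω ∈ openConn z b).card ≤ j}
  set ZB : Set (BondConfig V) :=
    {ω : BondConfig V | ¬ 1 ≤ (A.filter fun b => ω ∈ openConn y b ∨ ω ∈ openConn z b).card} with hZB
  set Zy : Set (BondConfig V) := {ω : BondConfig V | ¬ 1 ≤ (A.filter fun b => ω ∈ openConn y b).card} with hZy
  set Zz : Set (BondConfig V) := {ω : BondConfig V | ¬ 1 ≤ (A.filter fun b => ω ∈ openConn z b).card} with hZz
  have hyB : ∀ ω : BondConfig V, (A.filter fun b => ω ∈ openConn y b) ⊆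
      (A.filter fun b => ω ∈ openConn y b ∨ ω ∈ openConn z b) := fun ω b hb => by
    rw [Finset.mem_filter] at hb ⊢; exact ⟨hb.1, Or.inl hb.2⟩
  have hzB0 : ∀ ω : BondConfig V, ¬ 1 ≤ (A.filter fun b => ω ∈ openConn y b).card →
      (A.filter fun b => ω ∈ openConn y b ∨ ω ∈ openConn z b) = (A.filter fun b => ω ∈ openConn z b) := by
    intro ω h0
    have hempty : ∀ b ∈ A, ω ∉ openConn y b := by
      intro b hb hyb
      exact h0 (Finset.card_pos.2 ⟨b, Finset.mem_filter.2 ⟨hb, hyb⟩⟩)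
    exact Finset.filter_congr fun b hb => ⟨fun h => h.resolve_left (hempty b hb), fun h => Or.inr h⟩
  -- `{x ≁ B} ∩ M_B ⊆ ({x ≁ B} ∩ M_y) ∪ (Z_y ∩ M_z ∩ {x ↮ z})`
  have e7 : (XY ∪ XZ)ᶜ ∩ MB ⊆ ((XY ∪ XZ)ᶜ ∩ My) ∪ (Zy ∩ Mz ∩ XZᶜ) := by
    rintro ω ⟨hnb, ⟨hB1, hBj⟩⟩
    have hnb' := hnb
    simp only [mem_compl_iff, mem_union, not_or] at hnb'
    by_cases hy : 1 ≤ (A.filter fun b => ω ∈ openConn y b).card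
    · left
      refine ⟨hnb, ⟨hy, le_trans (Finset.card_le_card (hyB ω)) hBj⟩⟩
    · right
      have hEq := hzB0 ω hy
      refine ⟨⟨show ω ∈ Zy from hy, ⟨?_, ?_⟩⟩, hnb'.2⟩
      · simpa [hEq] using hB1
      · simpa [hEq] using hBj
  -- `Z_B = Z_y ∩ Z_z`
  have e8 : ZB ∩ Lc = Zy ∩ Zz ∩ Lc := by
    ext ω
    simp only [mem_inter_iff, hZB, hZy, hZz, mem_setOf_eq]
    constructor
    · rintro ⟨hB, hL⟩
      have hy : ¬ 1 ≤ (A.filter fun b => ω ∈ openConn y b).card :=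
        fun h => hB (le_trans h (Finset.card_le_card (hyB ω)))
      refine ⟨⟨hy, fun hz => hB ?_⟩, hL⟩
      rwa [hzB0 ω hy]
    · rintro ⟨⟨hy, hz⟩, hL⟩
      refine ⟨fun hB => hz ?_, hL⟩
      rwa [hzB0 ω hy] at hB
  have h7 : μ.real ((XY ∪ XZ)ᶜ ∩ MB) ≤ μ.real ((XY ∪ XZ)ᶜ ∩ My) + μ.real (Zy ∩ Mz ∩ XZᶜ) :=
    (measureReal_mono e7).trans (measureReal_union_le _ _)
  rw [e8]
  linarith [h7, hPW]

/-- **GLUE-ADM for a pair from COND-CIL and RED0** (exact trichotomy of the glued-pair T-witness inequality).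
For `x ∈ A`, vertices `y, z, c, a`, level `j`: if
`μ(Z_y ∩ M_z) + μ(Z_y ∩ Z_z ∩ L_c) ≤ μ(Z_y ∩ L_a)` (COND-CIL at `c`, witness `a`) and
`μ(M_y) + μ(Z_y ∩ L_a) + μ({x↔z} ∩ {y↮z} ∩ V_y ∩ L_x) ≤ μ(L_x) + μ({x↔z} ∩ {y↮z} ∩ M_y ∩ V_z)` (RED0 at `a`), then
`μ(x ≁ B, 1 ≤ N_B ≤ j) + μ(N_B = 0, N_c ≤ j) ≤ μ(x ≁ B, N_x ≤ j)` for `B = {y, z}`.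
[cite: KozmaNitzan2024, §3.2 (pp. 12–14: the `Σ_W P(C(0)=W)` bookkeeping of 'good' quadruples, here for the unattached cluster of `y`)] -/
theorem gluedPair_of_condCIL_red0 (w : Sym2 V → unitInterval) (A : Finset V) (x y z c a : V) (j : ℕ)
    (hx : x ∈ A)
    (hCC : (prodBernoulli w).real
            ({ω : BondConfig V | ¬ 1 ≤ (A.filter fun b => ω ∈ openConn y b).card} ∩
              {ω | 1 ≤ (A.filter fun b => ω ∈ openConn z b).card ∧ (A.filter fun b => ω ∈ openConn z b).card ≤ j}) +
          (prodBernoulli w).real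
            ({ω : BondConfig V | ¬ 1 ≤ (A.filter fun b => ω ∈ openConn y b).card} ∩
              {ω | ¬ 1 ≤ (A.filter fun b => ω ∈ openConn z b).card} ∩
              {ω | (A.filter fun b => ω ∈ openConn c b).card ≤ j}) ≤
        (prodBernoulli w).real
            ({ω : BondConfig V | ¬ 1 ≤ (A.filter fun b => ω ∈ openConn y b).card} ∩
              {ω | (A.filter fun b => ω ∈ openConn a b).card ≤ j}))
    (hRED0 : (prodBernoulli w).real
            {ω : BondConfig V | 1 ≤ (A.filter fun b => ω ∈ openConn y b).card ∧ (A.filter fun b => ω ∈ openConn y b).card ≤ j} +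
          (prodBernoulli w).real
            ({ω : BondConfig V | ¬ 1 ≤ (A.filter fun b => ω ∈ openConn y b).card} ∩
              {ω | (A.filter fun b => ω ∈ openConn a b).card ≤ j}) +
          (prodBernoulli w).real
            (openConn x z ∩ (openConn y z)ᶜ ∩ {ω | j < (A.filter fun b => ω ∈ openConn y b).card} ∩
              {ω | (A.filter fun b => ω ∈ openConn x b).card ≤ j}) ≤
        (prodBernoulli w).real {ω : BondConfig V | (A.filter fun b => ω ∈ openConn x b).card ≤ j} +
          (prodBernoulli w).real
            (openConn x z ∩ (openConn y z)ᶜ ∩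
              {ω | 1 ≤ (A.filter fun b => ω ∈ openConn y b).card ∧ (A.filter fun b => ω ∈ openConn y b).card ≤ j} ∩
              {ω | j < (A.filter fun b => ω ∈ openConn z b).card})) :
    (prodBernoulli w).real
        ((openConn x y ∪ openConn x z)ᶜ ∩
          {ω : BondConfig V | 1 ≤ (A.filter fun b => ω ∈ openConn y b ∨ ω ∈ openConn z b).card ∧
            (A.filter fun b => ω ∈ openConn y b ∨ ω ∈ openConn z b).card ≤ j}) +
      (prodBernoulli w).real
        ({ω : BondConfig V | ¬ 1 ≤ (A.filter fun b => ω ∈ openConn y b ∨ ω ∈ openConn z b).card} ∩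
          {ω | (A.filter fun b => ω ∈ openConn c b).card ≤ j}) ≤
    (prodBernoulli w).real
        ((openConn x y ∪ openConn x z)ᶜ ∩ {ω : BondConfig V | (A.filter fun b => ω ∈ openConn x b).card ≤ j}) := by
  classical
  set μ := prodBernoulli w
  -- events
  set XY : Set (BondConfig V) := openConn x y with hXY
  set XZ : Set (BondConfig V) := openConn x z with hXZ
  set YZ : Set (BondConfig V) := openConn y z with hYZ
  set Lx : Set (BondConfig V) := {ω : BondConfig V | (A.filter fun b => ω ∈ openConn x b).card ≤ j} with hLx
  set La : Set (BondConfig V) := {ω : BondConfig V | (A.filter fun b => ω ∈ openConn a b).card ≤ j}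
  set Lc : Set (BondConfig V) := {ω : BondConfig V | (A.filter fun b => ω ∈ openConn c b).card ≤ j}
  set Ay : Set (BondConfig V) := {ω : BondConfig V | 1 ≤ (A.filter fun b => ω ∈ openConn y b).card} with hAy
  set Az : Set (BondConfig V) := {ω : BondConfig V | 1 ≤ (A.filter fun b => ω ∈ openConn z b).card}
  set Vy : Set (BondConfig V) := {ω : BondConfig V | j < (A.filter fun b => ω ∈ openConn y b).card} with hVy
  set Vz : Set (BondConfig V) := {ω : BondConfig V | j < (A.filter fun b => ω ∈ openConn z b).card} with hVz
  set My : Set (BondConfig V) :=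
    {ω : BondConfig V | 1 ≤ (A.filter fun b => ω ∈ openConn y b).card ∧ (A.filter fun b => ω ∈ openConn y b).card ≤ j}
    with hMy
  set Mz : Set (BondConfig V) :=
    {ω : BondConfig V | 1 ≤ (A.filter fun b => ω ∈ openConn z b).card ∧ (A.filter fun b => ω ∈ openConn z b).card ≤ j}
    with hMz
  set MB : Set (BondConfig V) :=
    {ω : BondConfig V | 1 ≤ (A.filter fun b => ω ∈ openConn y b ∨ ω ∈ openConn z b).card ∧
      (A.filter fun b => ω ∈ openConn y b ∨ ω ∈ openConn z b).card ≤ j}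
  set ZB : Set (BondConfig V) :=
    {ω : BondConfig V | ¬ 1 ≤ (A.filter fun b => ω ∈ openConn y b ∨ ω ∈ openConn z b).card}
  set Zy : Set (BondConfig V) := {ω : BondConfig V | ¬ 1 ≤ (A.filter fun b => ω ∈ openConn y b).card} with hZy
  set Zz : Set (BondConfig V) := {ω : BondConfig V | ¬ 1 ≤ (A.filter fun b => ω ∈ openConn z b).card}
  have hsplit : ∀ S T : Set (BondConfig V), μ.real S = μ.real (S ∩ T) + μ.real (S ∩ Tᶜ) := by
    intro S T
    rw [← measureReal_inter_add_sdiff (s := S) (MeasurableSet.of_discrete : MeasurableSet T), Set.sdiff_eq]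
  -- relay-count dictionary
  have hfx : ∀ {ω : BondConfig V} {u v : V}, (openGraph ω).Reachable u v →
      (A.filter fun b => ω ∈ openConn u b) = (A.filter fun b => ω ∈ openConn v b) :=
    fun h => filter_openConn_eq_of_mem h A
  have hxpos : ∀ ω : BondConfig V, 1 ≤ (A.filter fun b => ω ∈ openConn x b).card := fun ω =>
    Finset.card_pos.2 ⟨x, Finset.mem_filter.2 ⟨hx, show (openGraph ω).Reachable x x from SimpleGraph.Reachable.refl _⟩⟩
  -- (e1) on `{x ↔ y}`: `M_y = L_x`
  have e1 : My ∩ XY = Lx ∩ XY := by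
    ext ω
    simp only [mem_inter_iff, hMy, hLx, hXY, mem_setOf_eq]
    constructor
    · rintro ⟨⟨_, h2⟩, hxy⟩
      exact ⟨by rwa [hfx (show (openGraph ω).Reachable x y from hxy)], hxy⟩
    · rintro ⟨h, hxy⟩
      refine ⟨⟨?_, ?_⟩, hxy⟩
      · rw [← hfx (show (openGraph ω).Reachable x y from hxy)]; exact hxpos ω
      · rwa [← hfx (show (openGraph ω).Reachable x y from hxy)]
  -- (e2) `{x↔z} ∖ {x↔y} = {x↔z} ∩ {y↮z}`
  have e2 : ∀ S : Set (BondConfig V), S ∩ XYᶜ ∩ XZ = XZ ∩ YZᶜ ∩ S := by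
    intro S; ext ω
    simp only [mem_inter_iff, mem_compl_iff, hXY, hXZ, hYZ, openConn, mem_setOf_eq]
    constructor
    · rintro ⟨⟨hS, hnxy⟩, hxz⟩
      exact ⟨⟨hxz, fun hyz => hnxy (hxz.trans hyz.symm)⟩, hS⟩
    · rintro ⟨⟨hxz, hnyz⟩, hS⟩
      exact ⟨⟨hS, fun hxy => hnyz (hxy.symm.trans hxz)⟩, hxz⟩
  have e3 : ∀ S : Set (BondConfig V), S ∩ XYᶜ ∩ XZᶜ = (XY ∪ XZ)ᶜ ∩ S := by
    intro S; ext ω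
    simp only [mem_inter_iff, mem_compl_iff, mem_union, not_or]
    tauto
  -- (e4) on `{x ↔ z}`: `L_xᶜ = V_z`
  have e4 : XZ ∩ YZᶜ ∩ My ∩ Lxᶜ = XZ ∩ YZᶜ ∩ My ∩ Vz := by
    ext ω
    simp only [mem_inter_iff, mem_compl_iff, hLx, hVz, hXZ, mem_setOf_eq, not_le]
    constructor
    · rintro ⟨⟨⟨hxz, hn⟩, hM⟩, h⟩
      exact ⟨⟨⟨hxz, hn⟩, hM⟩, by rwa [← hfx (show (openGraph ω).Reachable x z from hxz)]⟩
    · rintro ⟨⟨⟨hxz, hn⟩, hM⟩, h⟩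
      exact ⟨⟨⟨hxz, hn⟩, hM⟩, by rwa [hfx (show (openGraph ω).Reachable x z from hxz)]⟩
  -- (e6) `Z_y ∩ M_z ∩ {x↔z} = {x↔z} ∩ {y↮z} ∩ L_x ∩ V_yᶜ ∩ A_yᶜ`
  have e6 : XZ ∩ YZᶜ ∩ Lx ∩ Vyᶜ ∩ Ayᶜ = Zy ∩ Mz ∩ XZ := by
    ext ω
    simp only [mem_inter_iff, mem_compl_iff, hLx, hVy, hAy, hZy, hMz, hXZ, hYZ, mem_setOf_eq, not_lt, not_le]
    constructor
    · rintro ⟨⟨⟨⟨hxz, _⟩, hL⟩, _⟩, hy0⟩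
      have hxz' : (openGraph ω).Reachable x z := hxz
      refine ⟨⟨hy0, ?_, ?_⟩, hxz⟩
      · rw [← hfx hxz']; exact hxpos ω
      · rw [← hfx hxz']; exact hL
    · rintro ⟨⟨hy0, _, hz2⟩, hxz⟩
      have hxz' : (openGraph ω).Reachable x z := hxz
      have hL : (A.filter fun b => ω ∈ openConn x b).card ≤ j := by rw [hfx hxz']; exact hz2
      refine ⟨⟨⟨⟨hxz, fun hyz => ?_⟩, hL⟩, ?_⟩, hy0⟩
      · -- `y ↔ z ↔ x` would attach `y` (to the relay `x`)
        have hyz' : (openGraph ω).Reachable y z := hyz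
        have : 1 ≤ (A.filter fun b => ω ∈ openConn y b).card := by
          rw [hfx (hyz'.trans hxz'.symm)]; exact hxpos ω
        omega
      · omega
  -- finite additivity
  have s1 : μ.real My = μ.real (My ∩ XY) + μ.real (My ∩ XYᶜ) := hsplit My XY
  have s2 : μ.real (My ∩ XYᶜ) = μ.real (My ∩ XYᶜ ∩ XZ) + μ.real (My ∩ XYᶜ ∩ XZᶜ) := hsplit _ XZ
  have s3 : μ.real (XZ ∩ YZᶜ ∩ My) = μ.real (XZ ∩ YZᶜ ∩ My ∩ Lx) + μ.real (XZ ∩ YZᶜ ∩ My ∩ Lxᶜ) := hsplit _ Lx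
  have s4 : μ.real Lx = μ.real (Lx ∩ XY) + μ.real (Lx ∩ XYᶜ) := hsplit Lx XY
  have s5 : μ.real (Lx ∩ XYᶜ) = μ.real (Lx ∩ XYᶜ ∩ XZ) + μ.real (Lx ∩ XYᶜ ∩ XZᶜ) := hsplit _ XZ
  have s6 : μ.real (XZ ∩ YZᶜ ∩ Lx) = μ.real (XZ ∩ YZᶜ ∩ Lx ∩ Vy) + μ.real (XZ ∩ YZᶜ ∩ Lx ∩ Vyᶜ) := hsplit _ Vy
  have s7 : μ.real (XZ ∩ YZᶜ ∩ Lx ∩ Vyᶜ) =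
      μ.real (XZ ∩ YZᶜ ∩ Lx ∩ Vyᶜ ∩ Ay) + μ.real (XZ ∩ YZᶜ ∩ Lx ∩ Vyᶜ ∩ Ayᶜ) := hsplit _ Ay
  have s8 : μ.real (Zy ∩ Mz) = μ.real (Zy ∩ Mz ∩ XZ) + μ.real (Zy ∩ Mz ∩ XZᶜ) := hsplit _ XZ
  -- rewrite the pieces
  rw [e2 My] at s2
  rw [e3 My] at s2
  rw [e2 Lx, e3 Lx] at s5
  rw [e4] at s3
  rw [e1] at s1
  have s7a : XZ ∩ YZᶜ ∩ Lx ∩ Vyᶜ ∩ Ay = XZ ∩ YZᶜ ∩ My ∩ Lx := by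
    ext ω
    simp only [mem_inter_iff, mem_compl_iff, hMy, hVy, hAy, mem_setOf_eq, not_lt]
    tauto
  rw [s7a, e6] at s7
  -- `μ.real (My ∩ XY) = μ.real (Lx ∩ XY)` is literally `s1`'s first term after `e1`; the `V_y`-piece of `L_x ∩ {x↔z}`
  have s6a : XZ ∩ YZᶜ ∩ Lx ∩ Vy = XZ ∩ YZᶜ ∩ Vy ∩ Lx := by
    ext ω; simp only [mem_inter_iff]; tauto
  rw [s6a] at s6
  -- the priority-witness inequality follows; conclude with `gluedPair_of_priorityWitness`
  exact gluedPair_of_priorityWitness w A x y z c j (by linarith [hCC, hRED0, s1, s2, s3, s4, s5, s6, s7, s8])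

end Summit.CriticalPhenomena.PercolationContinuityZ3.Theorems

end
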